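import Mathlib

/-!
# LitInterpolation — Hsieh 2014, Proposition 4.9 (the evaluation formula of the Katz measure), typed AS PRINTED

Blind re-derivation cell `pub-hodge-repro`, Tier-4 literature seat `t4-lit-4` (gen 0).  Target tree path
`lean/Summits/Ventures/HodgeRepro/Tier4/LitInterpolation.lean`; imports Mathlib only.  Companion of
`Tier4/LitMuInvariant.lean` (Theorem A of the same paper).

THE STATEMENT (author copy = arXiv:1112.1574v3 TeX, operator deposit HOME/lit-deposits/Hsieh2014-arxiv1112.1574/,
Main_Body.tex L422–L427; proofs/t4/inputs/t4-lit-4.md rows I-t4-lit-4-2 / -10):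
«Proposition 4.9. Let (Ω_∞, Ω_p) ∈ (ℂ^×)^Σ × (ℤ̄_p^×)^Σ be the complex and p-adic CM periods of (K, Σ) respectively.
Then we have
  (1/Ω_p^{kΣ+2κ}) · ∫_{Z(𝔠)} χ̂ dℒ_{𝔠,Σ} = L^{(p𝔠)}(0, χ) · Eul_p(χ) Eul_{𝔠^+}(χ)
      × (π^κ Γ_Σ(kΣ+κ)) / (√|D_F|_ℝ (Im ϑ)^κ · Ω_∞^{kΣ+2κ}) · [𝒪_K^× : 𝒪_F^×] · t_K,
where t_K = (#𝒰^alg / [𝒪_K^× : 𝒪_F^×]) · (2^r / #Cl_−^alg).  Note that t_K is a power of 2.»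
Standing data (§4.1, L168–L170): «Let λ be a Hecke character of K^× with infinity type kΣ+κ(1−c), where k ≥ 1 is an
integer and κ = Σ κ_σ σ ∈ ℤ[Σ], κ_σ ≥ 0.  We suppose that 𝔠 is divisible by the prime-to-p conductor of λ.»; the
measure (§4.4, L415–L419): «ℒ_{𝔠,Σ} the p-adic measure on Z(𝔠) such that … ∫_{Z(𝔠)} χ̂ dℒ_{𝔠,Σ} = Σ_{a∈𝒟_1} χ(a)
θ^κ ℰ_{χ,𝔠(a)}(x(a))» for «χ̂ the p-adic avatar of a Hecke character χ of infinity type kΣ+κ(1−c)»; the modified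
Euler factors ((4.16), L407–L410): «Eul_p(χ) := ∏_{w∈Σ_p} Eul(χ_w); Eul_{𝔠^+}(χ) = ∏_{w|𝔉} Eul(χ_w), where
Eul(χ_w) := χ_w(2ϑ_w) · L(0, χ_w) / (ε(0, χ_w, ψ) L(1, χ_w^{−1}))»; the embeddings (L50): «Fix two embeddings
ι_∞: ℚ̄ → ℂ and ι_p: ℚ̄ → ℚ̄_p once and for all» — the identity is an identity of ALGEBRAIC numbers read through them
(Katz 1978 (5.3.4)–(5.3.6), row I-t4-lit-4-8: Ⓐ «lies in incl(p)ℚ̄», Ⓑ «lies in incl(∞)ℚ̄», «incl(p)^{−1}(Ⓐ) =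
incl(∞)^{−1}(Ⓑ)»).  The author's 2021 revision inserts (−1)^{kΣ} in the archimedean factor (t3-lit §D26.1 H1) —
a unit, immaterial for the vanishing statement below; the Crelle print is not held (W14-print).

HOW IT IS TYPED.  An interface datum `InterpolationData A B F`: `A` the ring of integers of the p-adic field of
values, `B ⊇ A` a field (ℂ_p), `F` the field of algebraic numbers with its two embeddings `ιp : F →+* B`,
`ιinf : F →+* ℂ`; `Char` the avatars χ̂ in the printed range; `integral χ ∈ A` the p-adic integral; `omegaP χ ∈ A^×`
the period power Ω_p^{kΣ+2κ}; on the complex side the printed FACTORS as named complex numbers — `Lvalue χ` =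
L^{(p𝔠)}(0, χ), `eulP χ`, `eulC χ` = Eul_p(χ), Eul_{𝔠⁺}(χ), `arch χ` = π^κ Γ_Σ(kΣ+κ)/(√|D_F|_ℝ (Im ϑ)^κ Ω_∞^{kΣ+2κ}),
`unitIndex` = [𝒪_K^× : 𝒪_F^×], `tK` = t_K (a power of two) — and the printed hypotheses as Prop fields.  The named
Prop `Hsieh2014_Prop4_9 D` says: for every χ̂ there is an algebraic number `a ∈ F` with `ιp a = integral χ / Ω_p^{…}`
in `B` and `ιinf a = L^{(p𝔠)}(0,χ) · Eul_p · Eul_{𝔠⁺} · arch · [𝒪_K^×:𝒪_F^×] · t_K` in ℂ.  PROVED here (Mathlib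
only): the vanishing transfer `integral_eq_zero_iff_Lvalue_eq_zero` — under the Proposition as a hypothesis and the
non-vanishing of the factors other than the L-value (the modified Euler factors: Lemma E / Tier3GaussSumPair on the
line's side; the archimedean factor and the indices are non-zero by their printed form), the p-adic integral vanishes
iff the L-value does — the shape of LINE L2's displayed input `central_eq_zero_iff` (Skeleton.lean L298–L302).

HONESTY.  The factors are DATA named after the printed expressions; nothing about L-functions, Euler factors or
periods is proved; the Proposition enters only as a hypothesis.  Nothing here says anything about the status of
the Hodge conjecture for CM abelian varieties, which is NOT proved.
-/

set_option autoImplicit false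

noncomputable section

namespace Summit.Ventures.HodgeRepro.Tier4.Lit.Interpolation

variable {A B F : Type*} [CommRing A] [Field B] [Algebra A B] [Field F]

/-- **The datum of Hsieh 2014, Proposition 4.9** (see the module docstring for every locator). -/
structure InterpolationData (A B F : Type*) [CommRing A] [Field B] [Algebra A B] [Field F] where
  /-- the p-adic avatars `χ̂` of the Hecke characters `χ` of infinity type `kΣ+κ(1−c)`, `k ≥ 1`, `κ_σ ≥ 0`, with `𝔠`
  divisible by the prime-to-p conductor (§4.1 L168–L170), as characters of `Z(𝔠)` (L54: the ray class group modulo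
  `𝔠p^∞`). -/
  Char : Type
  /-- `∫_{Z(𝔠)} χ̂ dℒ_{𝔠,Σ} ∈ A` (L418–L419). -/
  integral : Char → A
  /-- `Ω_p^{kΣ+2κ} ∈ A^×`, the p-adic CM period power (`Ω_p ∈ (ℤ̄_p^×)^Σ`, L422). -/
  omegaP : Char → A
  omegaP_isUnit : ∀ χ, IsUnit (omegaP χ)
  /-- `ι_p : ℚ̄ → ℚ̄_p ⊂ B` (L50). -/
  ιp : F →+* B
  /-- `ι_∞ : ℚ̄ → ℂ` (L50). -/
  ιinf : F →+* ℂ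
  /-- `L^{(p𝔠)}(0, χ)` — the Hecke L-value at `0` with the Euler factors at `p𝔠` removed (L423). -/
  Lvalue : Char → ℂ
  /-- `Eul_p(χ) = ∏_{w∈Σ_p} χ_w(2ϑ_w) · L(0, χ_w) / (ε(0, χ_w, ψ) L(1, χ_w^{−1}))` ((4.16), L407–L410). -/
  eulP : Char → ℂ
  /-- `Eul_{𝔠⁺}(χ) = ∏_{w|𝔉} Eul(χ_w)` ((4.16)). -/
  eulC : Char → ℂ
  /-- `π^κ Γ_Σ(kΣ+κ) / (√|D_F|_ℝ (Im ϑ)^κ · Ω_∞^{kΣ+2κ})` (L424; the 2021 revision: times `(−1)^{kΣ}`). -/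
  arch : Char → ℂ
  /-- `[𝒪_K^× : 𝒪_F^×]` (L424). -/
  unitIndex : ℕ
  /-- `t_K = (#𝒰^alg / [𝒪_K^× : 𝒪_F^×]) · (2^r / #Cl_−^alg)`, «a power of 2» (L425–L426). -/
  tK : ℕ
  tK_pow : ∃ r : ℕ, tK = 2 ^ r
  /-- «Let p > 2 be an odd rational prime» (L50). -/
  pOdd : Prop
  /-- «(ord) Every prime of F above p splits in K» (L51). -/
  ord : Prop
  /-- the p-ordinary CM type `Σ` (L52). -/
  pOrdinaryType : Prop
  /-- `ϑ ∈ K` with `ϑ^c = −ϑ`, `Im σ(ϑ) > 0` for `σ ∈ Σ`, and `𝔠(𝒪_K) = 𝒟_F^{−1}(2ϑ𝒟_{K/F}^{−1})` prime to `𝔇`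
  (§3.1 (d1)–(d2), L104–L107). -/
  thetaChoice : Prop

namespace InterpolationData

variable (D : InterpolationData A B F)

/-- the printed standing hypotheses, bundled. -/
def Hypotheses : Prop := D.pOdd ∧ D.ord ∧ D.pOrdinaryType ∧ D.thetaChoice

/-- the p-adic side `(1/Ω_p^{kΣ+2κ}) · ∫ χ̂ dℒ_{𝔠,Σ}`, in `B`. -/
def padicSide (χ : D.Char) : B := algebraMap A B (D.integral χ) / algebraMap A B (D.omegaP χ)

/-- the complex side `L^{(p𝔠)}(0,χ) · Eul_p(χ) Eul_{𝔠⁺}(χ) · arch · [𝒪_K^×:𝒪_F^×] · t_K`. -/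
def complexSide (χ : D.Char) : ℂ :=
  D.Lvalue χ * D.eulP χ * D.eulC χ * D.arch χ * (D.unitIndex : ℂ) * (D.tK : ℂ)

end InterpolationData

/-- **Hsieh 2014, Proposition 4.9, as printed** (Main_Body.tex L422–L427; rows I-t4-lit-4-2 / -10): over the datum
`D`, under its standing hypotheses, for every `χ̂` the two sides are the same ALGEBRAIC number read through `ι_p`
and `ι_∞`. -/
def Hsieh2014_Prop4_9 (D : InterpolationData A B F) : Prop :=
  D.Hypotheses → ∀ χ : D.Char, ∃ a : F, D.ιp a = D.padicSide χ ∧ D.ιinf a = D.complexSide χ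

/-- **Corollary (proved): the vanishing transfer.**  Under the Proposition (as a hypothesis), `algebraMap A B`
injective, and the non-vanishing of every complex factor other than the L-value, the p-adic integral of `χ̂`
vanishes iff `L^{(p𝔠)}(0, χ)` does. -/
theorem Hsieh2014_Prop4_9.integral_eq_zero_iff_Lvalue_eq_zero {D : InterpolationData A B F}
    (h : Hsieh2014_Prop4_9 D) (hD : D.Hypotheses) (hinj : Function.Injective (algebraMap A B))
    (χ : D.Char) (heulP : D.eulP χ ≠ 0) (heulC : D.eulC χ ≠ 0) (harch : D.arch χ ≠ 0)
    (hindex : D.unitIndex ≠ 0) :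
    D.integral χ = 0 ↔ D.Lvalue χ = 0 := by
  obtain ⟨a, hap, hainf⟩ := h hD χ
  have htK : (D.tK : ℂ) ≠ 0 := by
    obtain ⟨r, hr⟩ := D.tK_pow
    rw [hr]; exact_mod_cast pow_ne_zero r two_ne_zero
  have hΩ : algebraMap A B (D.omegaP χ) ≠ 0 := by
    intro h0
    have := (D.omegaP_isUnit χ).map (algebraMap A B)
    rw [h0] at this
    exact not_isUnit_zero this
  -- `integral χ = 0 ↔ a = 0`
  have h1 : D.integral χ = 0 ↔ a = 0 := by
    constructor
    · intro hi
      apply D.ιp.injective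
      rw [hap, InterpolationData.padicSide, hi, map_zero, zero_div, map_zero]
    · intro ha
      rw [ha, map_zero, InterpolationData.padicSide] at hap
      have : algebraMap A B (D.integral χ) = 0 := by
        rcases div_eq_zero_iff.mp hap.symm with h' | h'
        · exact h'
        · exact absurd h' hΩ
      exact hinj (by rw [this, map_zero])
  -- `a = 0 ↔ Lvalue χ = 0`
  have h2 : a = 0 ↔ D.Lvalue χ = 0 := by
    constructor
    · intro ha
      rw [ha, map_zero, InterpolationData.complexSide] at hainf
      have hprod := hainf.symm
      simp only [mul_eq_zero] at hprod
      rcases hprod with ((((hL | hP) | hC) | hA) | hI) | hT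
      · exact hL
      · exact absurd hP heulP
      · exact absurd hC heulC
      · exact absurd hA harch
      · exact absurd (by exact_mod_cast hI) hindex
      · exact absurd hT htK
    · intro hL
      apply D.ιinf.injective
      rw [hainf, InterpolationData.complexSide, hL, map_zero]
      ring
  exact h1.trans h2

end Summit.Ventures.HodgeRepro.Tier4.Lit.Interpolation

end
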